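import Mathlib
import Summits.KontsevichZagierPeriods.Zeta5Search.ClassExpRigidityProof
import Summits.KontsevichZagierPeriods.Zeta5Search.RecordCellADigitsS
import HarnessLib

/-!
# ζ(5) search — LEMMA V4 (`PairCancellation`): the leading digits of `V_x` and `V_x̄` cancel for an extremal class

Cell `pub-zeta5` (HONEST FRAMING: systematic search; no irrationality claim unless certified), typer seat
generation 9.  Discharges BY NAME gen-2 g8's `PairCancellation` (`Zeta5Search/ClusterValuationPairs.lean` §3b; REPORT-gen2-g8
§2.3, Lemma V4; exact check there 238/238):

* `pairCancellation_holds : PairCancellation` — for a class `x` with at least two poles and `E_x = −(N_p+1)`,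
  `v_p(V_x + V_x̄) ≥ −N_p`.

PROOF.  By `classExpRigidity_holds` (Lemma V1′, typer g9) such a class is `{x, x+p}` (levels 0 and 1, `x + p ≤ b₀ < x + 2p`),
not self-conjugate, of shape `(−1,−1)` with `N_p = 1` or `(−2,−2)` with `N_p = 3`; its conjugate is the class of
`r₀ = b₀ − x − p`, again at levels 0 and 1.  For shape `(−2,−2)` P1 g5's digit computations `CellA.classV_S` / `CellA.classV_Sbar`
(`p⁴V_x ≡ 3g`, `p⁴V_x̄ ≡ −3g (mod p)`, `g` the constant term of the foreign factor) give `‖p⁴(V_x + V_x̄)‖_p ≤ p⁻¹`; for shape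
`(−1,−1)` the same template gives `p²V_x ≡ −g`, `p²V_x̄ ≡ g' ≡ g` (`classV_11`, `classV_11bar`, with the coefficient formulas
`pf11_top/bot`: `c_{0,x+p} = −g/p`, `c_{0,x} = g'/p`), whence `‖p²(V_x + V_x̄)‖_p ≤ p⁻¹`.  The ingredients are P1 g5's
reflection `c_{o,b₀−q} = (−1)^o c_{o,q}`, the level-0/1 harmonic sums and `g ≡ g' (mod p)`.  `p`-adic norms of rational
numbers; nothing about irrationality.
-/

noncomputable section

open Finset PowerSeries

namespace Summit.KontsevichZagierPeriods.Zeta5Search.ClusterValuation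

open Summit.KontsevichZagierPeriods.Zeta5Search.DualSeries (InBox)
open Summit.KontsevichZagierPeriods.Zeta5Search.WedgeDictionary (pfData)
open Summit.KontsevichZagierPeriods.Zeta5Search.CasoratianValuation (InPolytope pairFloors)
open Summit.KontsevichZagierPeriods.Zeta5Search.PadicSeries
open Summit.KontsevichZagierPeriods.Zeta5Search.CellA
open Literature.NumberTheory.Transcendental.BallRivoal (harm)

variable {p : ℕ} [hp : Fact p.Prime]

/-! ### Shape `(1,1)`: the partial-fraction coefficients at the two points -/

section PF

variable (b : ℕ → ℤ) (hb : InPolytope b) (hwin : (b 0 + 2 : ℤ) < (p : ℤ) ^ 2) {q₀ : ℕ}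
  (hq₁ : q₀ + p ≤ (b 0).toNat)

include hb hwin hq₁

/-- **Type `(1,1)`, upper point**: with `netExp q₀ = netExp (q₀+p) = −1`: `c_{0,q₀+p} = −gTop₀/p` and `c_{o,q₀+p} = 0` for
`1 ≤ o < 6`. -/
theorem pf11_top (he₀ : netExp b q₀ = -1) (he₁ : netExp b (q₀ + p) = -1) :
    pfData b 0 (q₀ + p) = -gTop b p q₀ 0 / p ∧ (∀ o, 1 ≤ o → o < 6 → pfData b o (q₀ + p) = 0) := by
  have hm₀ : mult b q₀ = 5 := by have := mult_eq_netExp b q₀; omega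
  have hm₁ : mult b (q₀ + p) = 5 := by have := mult_eq_netExp b (q₀ + p); omega
  have hp0 : (p : ℚ) ≠ 0 := Nat.cast_ne_zero.2 hp.out.ne_zero
  have hδ : ((q₀ : ℚ) - ((q₀ + p : ℕ) : ℚ)) = -(p : ℚ) := by push_cast; ring
  have hp0' : 0 < p := hp.out.pos
  have hF : Gser b (q₀ + p) * linS (-(p : ℚ)) ^ 1 = Gout b (q₀ + p) q₀ := by
    rw [← hδ]; exact gser_mul_linS_pow b (by omega) (by omega) (by rw [hm₀])
  rw [pow_one] at hF
  obtain ⟨c0, -, -⟩ := coeff_of_mul_linS (neg_ne_zero.2 hp0) hF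
  have hc : ∀ {o : ℕ}, o < 6 → pfData b o (q₀ + p) = coeff (5 - o) (X ^ 5 * Gser b (q₀ + p)) := by
    intro o ho; rw [pfData_eq_coeff b hb hwin hq₁ ho, hm₁]
  refine ⟨?_, ?_⟩
  · rw [hc (by norm_num), coeff_X_pow_mul', if_pos (by norm_num), show 5 - 0 - 5 = 0 from rfl, c0]
    unfold gTop; rw [div_neg, neg_div]
  · intro o h1 h6
    rw [hc h6, coeff_X_pow_mul', if_neg (by omega)]

/-- **Type `(1,1)`, lower point**: `c_{0,q₀} = gBot₀/p` and `c_{o,q₀} = 0` for `1 ≤ o < 6`. -/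
theorem pf11_bot (he₀ : netExp b q₀ = -1) (he₁ : netExp b (q₀ + p) = -1) :
    pfData b 0 q₀ = gBot b p q₀ 0 / p ∧ (∀ o, 1 ≤ o → o < 6 → pfData b o q₀ = 0) := by
  have hm₀ : mult b q₀ = 5 := by have := mult_eq_netExp b q₀; omega
  have hm₁ : mult b (q₀ + p) = 5 := by have := mult_eq_netExp b (q₀ + p); omega
  have hp0 : (p : ℚ) ≠ 0 := Nat.cast_ne_zero.2 hp.out.ne_zero
  have hδ : (((q₀ + p : ℕ) : ℚ) - q₀) = (p : ℚ) := by push_cast; ring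
  have hp0' : 0 < p := hp.out.pos
  have hF : Gser b q₀ * linS (p : ℚ) ^ 1 = Gout b q₀ (q₀ + p) := by
    rw [← hδ]; exact gser_mul_linS_pow b hq₁ (by omega) (by rw [hm₁])
  rw [pow_one] at hF
  obtain ⟨c0, -, -⟩ := coeff_of_mul_linS hp0 hF
  have hc : ∀ {o : ℕ}, o < 6 → pfData b o q₀ = coeff (5 - o) (X ^ 5 * Gser b q₀) := by
    intro o ho; rw [pfData_eq_coeff b hb hwin (by omega) ho, hm₀]
  refine ⟨?_, ?_⟩
  · rw [hc (by norm_num), coeff_X_pow_mul', if_pos (by norm_num), show 5 - 0 - 5 = 0 from rfl, c0]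
    unfold gBot; rfl
  · intro o h1 h6
    rw [hc h6, coeff_X_pow_mul', if_neg (by omega)]

end PF

/-! ### Shape `(1,1)`: the leading digits of `V_x` and `V_x̄` -/

section TwoPoint

variable (b : ℕ → ℤ) (hb : InPolytope b) (hp5 : 5 ≤ p) (hwin : (b 0 + 2 : ℤ) < (p : ℤ) ^ 2) {q₀ : ℕ}
  (hq₀ : q₀ < p) (hq₁ : q₀ + p ≤ (b 0).toNat) (htop : (b 0).toNat < q₀ + 2 * p)

include hb hp5 hwin hq₀ hq₁ htop

/-- **`p²·V_x ≡ −g (mod p)`** for a class of type `(1,1)` (`g = gTop₀`). -/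
theorem classV_11 (he₀ : netExp b q₀ = -1) (he₁ : netExp b (q₀ + p) = -1) :
    padicNorm p ((p : ℚ) ^ 2 * classV b p q₀ + gTop b p q₀ 0) ≤ (p : ℚ) ^ (-(1 : ℤ)) := by
  have hp0 : (p : ℚ) ≠ 0 := Nat.cast_ne_zero.2 hp.out.ne_zero
  have hp2 : p ≠ 2 := by have := hp5; omega
  have hn : (b 0).toNat < p ^ 2 := (thmA_data b hb hwin).2.2.2
  obtain ⟨c0, hz⟩ := pf11_top b hb hwin hq₁ he₀ he₁
  obtain ⟨d0, hz'⟩ := pf11_bot b hb hwin hq₁ he₀ he₁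
  set g := gTop b p q₀ 0 with hg
  set g' := gBot b p q₀ 0 with hg'
  have ig : padicNorm p g ≤ 1 := padicNorm_gTop_le b hq₀ hq₁ htop hn hp2 0
  have ig' : padicNorm p g' ≤ 1 := padicNorm_gBot_le b hq₀ hq₁ htop hn hp2 0
  have ineg : padicNorm p (-g) ≤ 1 := by rw [padicNorm.neg]; exact ig
  have hV : classV b p q₀ = pfData b 0 q₀ * harm 1 q₀ + pfData b 0 (q₀ + p) * harm 1 (q₀ + p) := by
    rw [classV, classSet_twoPoint b hq₀ hq₁ htop hp.out.pos, sum_pair (by have := hp.out.pos; omega),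
      sum_range_six_of_ge_one (fun o h1 h6 => by rw [hz' o h1 h6, zero_mul]),
      sum_range_six_of_ge_one (fun o h1 h6 => by rw [hz o h1 h6, zero_mul])]
  have e : (p : ℚ) ^ 2 * classV b p q₀ + g =
      g' * ((p : ℚ) ^ 1 * harm 1 q₀) + ((-g) * ((p : ℚ) ^ 1 * harm 1 (q₀ + p)) - (-g)) := by
    rw [hV, d0, c0]
    field_simp
    ring
  rw [e]
  refine small_add (small_mul ig' (padicNorm_pow_mul_harm_le hq₀ le_rfl)) ?_
  refine approx_mul ineg (padicNorm_pow_mul_harm_sub_one_le (by omega) (by omega) le_rfl) ?_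
  rw [sub_self, padicNorm.zero]; exact zpow_p_nonneg _

/-- **`p²·V_x̄ ≡ g (mod p)`** for the conjugate `x̄ = {b₀−q₀−p, b₀−q₀}` of a class of type `(1,1)` — the opposite digit. -/
theorem classV_11bar (he₀ : netExp b q₀ = -1) (he₁ : netExp b (q₀ + p) = -1) :
    padicNorm p ((p : ℚ) ^ 2 * classV b p ((b 0).toNat - (q₀ + p)) - gTop b p q₀ 0) ≤ (p : ℚ) ^ (-(1 : ℤ)) := by
  have hp0 : (p : ℚ) ≠ 0 := Nat.cast_ne_zero.2 hp.out.ne_zero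
  have hp2 : p ≠ 2 := by have := hp5; omega
  have hn : (b 0).toNat < p ^ 2 := (thmA_data b hb hwin).2.2.2
  obtain ⟨hr₀, hr₁, hrtop, hr⟩ := conj_twoPoint_data b hq₀ hq₁ htop
  obtain ⟨c0, hz⟩ := pf11_top b hb hwin hq₁ he₀ he₁
  obtain ⟨d0, hz'⟩ := pf11_bot b hb hwin hq₁ he₀ he₁
  set r₀ := (b 0).toNat - (q₀ + p) with hr₀def
  set g := gTop b p q₀ 0 with hg
  set g' := gBot b p q₀ 0 with hg'
  have ig : padicNorm p g ≤ 1 := padicNorm_gTop_le b hq₀ hq₁ htop hn hp2 0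
  have ig' : padicNorm p g' ≤ 1 := padicNorm_gBot_le b hq₀ hq₁ htop hn hp2 0
  have ineg : padicNorm p (-g) ≤ 1 := by rw [padicNorm.neg]; exact ig
  have hgg : padicNorm p (g' - g) ≤ (p : ℚ) ^ (-(1 : ℤ)) := by
    rw [← padicNorm.neg, neg_sub]; exact padicNorm_gTop_sub_gBot_le b hq₀ hq₁ htop hn
  have hc : ∀ o, o < 6 → pfData b o r₀ = (-1 : ℚ) ^ o * pfData b o (q₀ + p) := fun o ho => (pfData_conj b hb hq₁ ho).1
  have hc' : ∀ o, o < 6 → pfData b o (r₀ + p) = (-1 : ℚ) ^ o * pfData b o q₀ := fun o ho => by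
    rw [hr]; exact (pfData_conj b hb hq₁ ho).2
  have hV : classV b p r₀ = pfData b 0 (q₀ + p) * harm 1 r₀ + pfData b 0 q₀ * harm 1 (r₀ + p) := by
    rw [classV, classSet_twoPoint b hr₀ hr₁ hrtop hp.out.pos, sum_pair (by have := hp.out.pos; omega),
      sum_range_six_of_ge_one (fun o h1 h6 => by rw [hc o h6, hz o h1 h6, mul_zero, zero_mul]),
      sum_range_six_of_ge_one (fun o h1 h6 => by rw [hc' o h6, hz' o h1 h6, mul_zero, zero_mul]),
      hc 0 (by norm_num), hc' 0 (by norm_num)]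
    ring
  have e : (p : ℚ) ^ 2 * classV b p r₀ - g =
      (-g) * ((p : ℚ) ^ 1 * harm 1 r₀) + (g' * ((p : ℚ) ^ 1 * harm 1 (r₀ + p)) - g) := by
    rw [hV, d0, c0]
    field_simp
    ring
  rw [e]
  refine small_add (small_mul ineg (padicNorm_pow_mul_harm_le hr₀ le_rfl)) ?_
  exact approx_mul ig' (padicNorm_pow_mul_harm_sub_one_le (by omega) (by omega) le_rfl) hgg

end TwoPoint

/-! ### From a normalised congruence to a valuation bound -/

/-- If `‖p^k · S‖_p ≤ p⁻¹` and `S ≠ 0` then `v_p(S) ≥ 1 − k`. -/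
theorem le_padicValRat_of_pow_mul {S : ℚ} (hS : S ≠ 0) (k : ℕ)
    (h : padicNorm p ((p : ℚ) ^ k * S) ≤ (p : ℚ) ^ (-(1 : ℤ))) : 1 - (k : ℤ) ≤ padicValRat p S := by
  have hpQ : (p : ℚ) ≠ 0 := Nat.cast_ne_zero.2 hp.out.ne_zero
  have hne : (p : ℚ) ^ k * S ≠ 0 := mul_ne_zero (pow_ne_zero _ hpQ) hS
  rw [padicNorm.eq_zpow_of_nonzero hne] at h
  have hp1 : (1 : ℚ) < p := by exact_mod_cast hp.out.one_lt
  have h' := (zpow_le_zpow_iff_right₀ hp1).1 h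
  have hv : padicValRat p ((p : ℚ) ^ k * S) = k + padicValRat p S := by
    rw [padicValRat.mul (pow_ne_zero _ hpQ) hS, padicValRat.pow, padicValRat.self hp.out.one_lt]; ring
  rw [hv] at h'
  linarith

/-! ### The structure of a two-point class from its cardinality -/

omit hp in
/-- A class of `x < p` with exactly two points is `{x, x + p}` with `x + p ≤ b₀ < x + 2p`. -/
theorem twoPoint_of_card_eq_two (b : ℕ → ℤ) {x : ℕ} (hp0 : 0 < p) (hx : x < p)
    (hcard : (classSet b p x).card = 2) : x + p ≤ (b 0).toNat ∧ (b 0).toNat < x + 2 * p := by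
  constructor
  · by_contra hlt
    push Not at hlt
    have hsub : classSet b p x ⊆ {x} := by
      intro s hs
      obtain ⟨hs1, k, hk⟩ := (mem_classSet_iff b x s).1 hs
      rw [mem_singleton]
      have hk0 : k = 0 := by
        by_contra hk0
        rcases lt_or_gt_of_ne hk0 with hneg | hpos
        · have : (p : ℤ) * k ≤ (p : ℤ) * (-1) := mul_le_mul_of_nonneg_left (by omega) (by omega)
          omega
        · have : (p : ℤ) * 1 ≤ (p : ℤ) * k := mul_le_mul_of_nonneg_left (by omega) (by omega)
          omega
      subst hk0
      omega
    have := card_le_card hsub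
    rw [card_singleton] at this
    omega
  · by_contra hge
    push Not at hge
    have hsub : ({x, x + p, x + 2 * p} : Finset ℕ) ⊆ classSet b p x := by
      intro s hs
      simp only [mem_insert, mem_singleton] at hs
      rw [mem_classSet_iff]
      rcases hs with rfl | rfl | rfl
      · exact ⟨by omega, by simp⟩
      · exact ⟨by omega, ⟨1, by push_cast; ring⟩⟩
      · exact ⟨hge, ⟨2, by push_cast; ring⟩⟩
    have hc3 : ({x, x + p, x + 2 * p} : Finset ℕ).card = 3 := by
      rw [card_insert_of_notMem, card_pair (by omega)]
      simp only [mem_insert, mem_singleton]; omega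
    have := card_le_card hsub
    omega

omit hp in
/-- `classV` depends on the base point only through its residue. -/
theorem classV_congr_mod (b : ℕ → ℤ) {y y' : ℕ} (h : y % p = y' % p) : classV b p y = classV b p y' := by
  unfold classV classSet
  rw [h]

/-! ### Lemma V4 -/

/-- **`PairCancellation` (Lemma V4) is a theorem.** -/
theorem pairCancellation_holds : PairCancellation := by
  intro b p x hb hprime hp5 hpb hwin hx hcount hE hne
  haveI : Fact p.Prime := ⟨hprime⟩
  have hodd : ¬ 2 ∣ p := by
    intro h2
    have := (Nat.prime_dvd_prime_iff_eq Nat.prime_two hprime).1 h2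
    omega
  obtain ⟨hcard, -, hshape⟩ := classExpRigidity_holds b p x hb hp5 hodd hpb hwin hx hcount hE
  have hp0 : 0 < p := hprime.pos
  obtain ⟨hq₁, htop⟩ := twoPoint_of_card_eq_two b hp0 hx hcard
  have hcls := classSet_twoPoint b hx hq₁ htop hp0
  have hxmem : x ∈ classSet b p x := by rw [hcls]; simp
  have hxpmem : x + p ∈ classSet b p x := by rw [hcls]; simp
  -- the conjugate class is the class of `r₀ = b₀ − x − p`
  have hconjV : classV b p (conjClass b p x) = classV b p ((b 0).toNat - (x + p)) := by
    refine classV_congr_mod b ?_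
    unfold conjClass
    rw [Nat.mod_mod, show (b 0).toNat - x = ((b 0).toNat - (x + p)) + p by omega, Nat.add_mod_right]
  rw [hconjV] at hne ⊢
  rcases hshape with ⟨hN1, hsh⟩ | ⟨hN3, hsh⟩
  · -- shape `(−1,−1)`, `N_p = 1`
    have he₀ := hsh x hxmem
    have he₁ := hsh (x + p) hxpmem
    have h1 := classV_11 b hb hp5 hwin hx hq₁ htop he₀ he₁
    have h2 := classV_11bar b hb hp5 hwin hx hq₁ htop he₀ he₁
    have hsum : padicNorm p ((p : ℚ) ^ 2 * (classV b p x + classV b p ((b 0).toNat - (x + p)))) ≤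
        (p : ℚ) ^ (-(1 : ℤ)) := by
      have e : (p : ℚ) ^ 2 * (classV b p x + classV b p ((b 0).toNat - (x + p))) =
          ((p : ℚ) ^ 2 * classV b p x + gTop b p x 0) +
            ((p : ℚ) ^ 2 * classV b p ((b 0).toNat - (x + p)) - gTop b p x 0) := by ring
      rw [e]; exact small_add h1 h2
    have := le_padicValRat_of_pow_mul hne 2 hsum
    rw [hN1]
    push_cast at this
    linarith
  · -- shape `(−2,−2)`, `N_p = 3`
    have he₀ := hsh x hxmem
    have he₁ := hsh (x + p) hxpmem
    have h1 := classV_S b hb hp5 hwin hx hq₁ htop he₀ he₁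
    have h2 := classV_Sbar b hb hp5 hwin hx hq₁ htop he₀ he₁
    have hsum : padicNorm p ((p : ℚ) ^ 4 * (classV b p x + classV b p ((b 0).toNat - (x + p)))) ≤
        (p : ℚ) ^ (-(1 : ℤ)) := by
      have e : (p : ℚ) ^ 4 * (classV b p x + classV b p ((b 0).toNat - (x + p))) =
          ((p : ℚ) ^ 4 * classV b p x - 3 * gTop b p x 0) +
            ((p : ℚ) ^ 4 * classV b p ((b 0).toNat - (x + p)) + 3 * gTop b p x 0) := by ring
      rw [e]; exact small_add h1 h2
    have := le_padicValRat_of_pow_mul hne 4 hsum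
    rw [hN3]
    push_cast at this
    linarith

end Summit.KontsevichZagierPeriods.Zeta5Search.ClusterValuation

end
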